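import Summits.CriticalPhenomena.SAWScalingLimit.Theorems.BoundaryClosureNegative_Profile

/-!
# Negative knowledge on crux `BoundaryClosure` — the corridor refutation of `HexObservableLimit`, part 6: the vertex sets `Lam δ wc` are connected and simply connected (connected complement).

Support for `SAWDefectDecoherenceHexObservableLimitRefutation.lean` (item stmt-CriticalPhenomena-5420, the conclusion of
crux `BoundaryClosure`, stmt-CriticalPhenomena-8536). Everything proved. [folklore]
-/

noncomputable section

open Set Filter Topology
open Literature.Probability.RandomPlanarGeometry
open Literature.Probability.LatticeModels Literature.Probability.RandomPlanarGeometry.SAW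

namespace Summit.CriticalPhenomena.SAWScalingLimit.Theorems.BoundaryClosure.Negative

/-! ### Connectivity of the vertex sets -/

section Connected

variable {δ : ℝ} (hδ : 0 < δ) (hδ' : δ ≤ 1 / 16) (wc : Bool)
include hδ hδ'


/-- `0 ≤ T` (indeed `T ≥ 3`). [folklore] -/
theorem Tc_nonneg : 0 ≤ Tc δ := by
  have := Xc_add_two_le_Tc hδ hδ'; have := Xc_pos hδ (δ := δ); omega

/-- Strip faces of rows `≥ 2` are vertices. [folklore] -/
theorem mem_of_inStrip_two_le {j r : ℤ} (h : (j, r) ∈ Strip δ) (hr : 2 ≤ r) : fj j r ∈ (↑(Lam δ wc) : Set HexVertex) :=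
  (fj_mem_coe_iff hδ hδ').2 (Or.inl ⟨h, fun h1 => by omega⟩)

/-- Strip faces left of the junction are vertices. [folklore] -/
theorem mem_of_inStrip_le {j r : ℤ} (h : (j, r) ∈ Strip δ) (hj : j ≤ 2 * Xc δ + 1) : fj j r ∈ (↑(Lam δ wc) : Set HexVertex) :=
  (fj_mem_coe_iff hδ hδ').2 (Or.inl ⟨h, fun _ => hj⟩)

/-- Corridor faces are vertices of the second set. [folklore] -/
theorem mem_of_inCorr (hwc : wc = true) {j r : ℤ} (h : (j, r) ∈ Corr δ) : fj j r ∈ (↑(Lam δ wc) : Set HexVertex) :=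
  (fj_mem_coe_iff hδ hδ').2 (Or.inr ⟨hwc, h⟩)

/-- **Descent to row `2`** inside the vertex set. [folklore] -/
theorem exists_rch_row_two (n : ℕ) :
    ∀ j : ℤ, (j, (n : ℤ) + 2) ∈ Strip δ → ∃ j', (j', (2:ℤ)) ∈ Strip δ ∧ (fj j (n + 2), fj j' 2) ∈ RchRel (↑(Lam δ wc) : Set HexVertex) := by
  induction n with
  | zero =>
    intro j h
    simp only [Nat.cast_zero, zero_add] at h ⊢
    exact ⟨j, h, rch_rfl (mem_of_inStrip_two_le hδ hδ' wc h le_rfl)⟩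
  | succ n ih =>
    intro j h
    push_cast at h ⊢
    have hrow : (2 : ℤ) ≤ n + 1 + 2 := by omega
    -- an even strip face `j₂` of the same row, adjacent or equal to `j`
    obtain ⟨j₂, hj₂, h₂, hR₂⟩ : ∃ j₂ : ℤ, j₂ % 2 = 0 ∧ (j₂, (n : ℤ) + 1 + 2) ∈ Strip δ ∧
        (fj j (n + 1 + 2), fj j₂ (n + 1 + 2)) ∈ RchRel (↑(Lam δ wc) : Set HexVertex) := by
      rcases Int.emod_two_eq_zero_or_one j with hj | hj
      · exact ⟨j, hj, h, rch_rfl (mem_of_inStrip_two_le hδ hδ' wc h hrow)⟩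
      · rcases inStrip_side h with h' | h'
        · refine ⟨j - 1, by omega, h', ?_⟩
          exact rch_symm (rch_of_adj (mem_of_inStrip_two_le hδ hδ' wc h' hrow)
            (mem_of_inStrip_two_le hδ hδ' wc h hrow) (by simpa using adj_fj_succ (j - 1) _))
        · exact ⟨j + 1, by omega, h', rch_of_adj (mem_of_inStrip_two_le hδ hδ' wc h hrow)
            (mem_of_inStrip_two_le hδ hδ' wc h' hrow) (adj_fj_succ j _)⟩
    -- vertical descent from `j₂`
    have h₃ : (j₂ + 1, (n : ℤ) + 2) ∈ Strip δ := by
      have := inStrip_down (by omega) h₂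
      have e : (n : ℤ) + 1 + 2 - 1 = n + 2 := by ring
      rwa [e] at this
    have hstep : (fj j₂ (n + 1 + 2), fj (j₂ + 1) (n + 2)) ∈ RchRel (↑(Lam δ wc) : Set HexVertex) :=
      rch_of_adj (mem_of_inStrip_two_le hδ hδ' wc h₂ hrow)
        (mem_of_inStrip_two_le hδ hδ' wc h₃ (by omega)) (by
          have := adj_fj_down hj₂ (n + 1 + 2)
          have e : (n : ℤ) + 1 + 2 - 1 = n + 2 := by ring
          rwa [e] at this)
    obtain ⟨j', hj', hR⟩ := ih (j₂ + 1) h₃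
    exact ⟨j', hj', rch_trans (rch_trans hR₂ hstep) hR⟩

/-- The faces `(0, r)`, `(1, r)` of the bottom rows are in the strip. [folklore] -/
theorem inStrip_small {j r : ℤ} (hj0 : 0 ≤ j) (hj : j ≤ 1) (h0 : 0 ≤ r) (h2 : r ≤ 2) : (j, r) ∈ Strip δ :=
  inStrip_of_small hδ hδ' h0 h2 (by
    have := Tc_nonneg hδ hδ'
    rw [abs_le]; constructor <;> omega)

/-- From a strip face of row `2` to the origin face `fj 0 0`. [folklore] -/
theorem rch_origin_of_inStrip_two {j : ℤ} (h : (j, 2) ∈ Strip δ) : (fj j 2, fj 0 0) ∈ RchRel (↑(Lam δ wc) : Set HexVertex) := by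
  have h02 : (0, 2) ∈ Strip δ := inStrip_small hδ hδ' le_rfl (by norm_num) (by norm_num) le_rfl
  have step1 : (fj j 2, fj 0 2) ∈ RchRel (↑(Lam δ wc) : Set HexVertex) := by
    refine rch_row_of_between (↑(Lam δ wc) : Set HexVertex) 2 j 0 fun i hi hi' => mem_of_inStrip_two_le hδ hδ' wc ?_ le_rfl
    rcases le_total j 0 with hj | hj
    · rw [min_eq_left hj] at hi; rw [max_eq_right hj] at hi'
      exact inStrip_of_between h h02 hi hi'
    · rw [min_eq_right hj] at hi; rw [max_eq_left hj] at hi'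
      exact inStrip_of_between h02 h hi hi'
  have hX := Xc_pos hδ (δ := δ)
  have step2 : (fj 0 2, fj 0 (2 - (2 : ℕ))) ∈ RchRel (↑(Lam δ wc) : Set HexVertex) := by
    refine rch_col_down (↑(Lam δ wc) : Set HexVertex) (by norm_num) 2 2 (mem_of_inStrip_two_le hδ hδ' wc h02 le_rfl) ?_
    intro i hi1 hi2
    push_cast at hi2
    exact ⟨mem_of_inStrip_le hδ hδ' wc (inStrip_small hδ hδ' le_rfl (by norm_num) (by omega) (by omega))
        (by omega),
      mem_of_inStrip_le hδ hδ' wc (inStrip_small hδ hδ' (by norm_num) le_rfl (by omega) (by omega))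
        (by omega)⟩
  simpa using rch_trans step1 step2

/-- From a vertex of the bottom two rows to the origin face. [folklore] -/
theorem rch_origin_of_le_one {j r : ℤ} (h0 : 0 ≤ r) (h1 : r ≤ 1) (hm : fj j r ∈ (↑(Lam δ wc) : Set HexVertex)) :
    (fj j r, fj 0 0) ∈ RchRel (↑(Lam δ wc) : Set HexVertex) := by
  have hX := Xc_pos hδ (δ := δ)
  have h0r : (0, r) ∈ Strip δ := inStrip_small hδ hδ' le_rfl (by norm_num) h0 (by omega)
  -- the body case, as a reusable claim
  have body : ∀ j : ℤ, (j, r) ∈ Body δ → (fj j r, fj 0 0) ∈ RchRel (↑(Lam δ wc) : Set HexVertex) := by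
    intro j hb
    have hjX : j ≤ 2 * Xc δ + 1 := hb.2 h1
    have step1 : (fj j r, fj 0 r) ∈ RchRel (↑(Lam δ wc) : Set HexVertex) := by
      refine rch_row_of_between (↑(Lam δ wc) : Set HexVertex) r j 0 fun i hi hi' => mem_of_inStrip_le hδ hδ' wc ?_ ?_
      · rcases le_total j 0 with hj | hj
        · rw [min_eq_left hj] at hi; rw [max_eq_right hj] at hi'
          exact inStrip_of_between hb.1 h0r hi hi'
        · rw [min_eq_right hj] at hi; rw [max_eq_left hj] at hi'
          exact inStrip_of_between h0r hb.1 hi hi'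
      · have : i ≤ max j 0 := hi'
        have : max j 0 ≤ 2 * Xc δ + 1 := max_le hjX (by omega)
        omega
    have step2 : (fj 0 r, fj 0 0) ∈ RchRel (↑(Lam δ wc) : Set HexVertex) := by
      rcases (by omega : r = 0 ∨ r = 1) with rfl | rfl
      · exact rch_rfl (mem_of_inStrip_le hδ hδ' wc h0r (by omega))
      · have := rch_col_down (↑(Lam δ wc) : Set HexVertex) (by norm_num : (0:ℤ) % 2 = 0) 1 1
          (mem_of_inStrip_le hδ hδ' wc h0r (by omega)) (by
            intro i hi1 hi2; push_cast at hi2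
            obtain rfl : i = 1 := le_antisymm hi2 hi1
            exact ⟨mem_of_inStrip_le hδ hδ' wc (inStrip_small hδ hδ' le_rfl (by norm_num) le_rfl
                (by norm_num)) (by omega),
              mem_of_inStrip_le hδ hδ' wc (inStrip_small hδ hδ' (by norm_num) le_rfl le_rfl
                (by norm_num)) (by omega)⟩)
        simpa using this
    exact rch_trans step1 step2
  rcases (fj_mem_coe_iff hδ hδ').1 hm with hb | ⟨hwc, hc⟩
  · exact body j hb
  · -- corridor face: walk left to the junction face `2X+1`, which is in the body
    obtain ⟨rfl, hc1, hc2⟩ := hc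
    have hJ : (2 * Xc δ + 1, 0) ∈ Body δ := by
      refine ⟨inStrip_of_small hδ hδ' le_rfl (by norm_num) ?_, fun _ => le_rfl⟩
      have := Xc_add_two_le_Tc hδ hδ'
      rw [abs_le]; constructor <;> omega
    have step1 : (fj (2 * Xc δ + 1) 0, fj j 0) ∈ RchRel (↑(Lam δ wc) : Set HexVertex) := by
      refine rch_row (↑(Lam δ wc) : Set HexVertex) 0 _ _ (by omega) fun i hi hi' => ?_
      rcases eq_or_lt_of_le hi with rfl | hlt
      · exact mem_of_inStrip_le hδ hδ' wc hJ.1 le_rfl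
      · exact mem_of_inCorr hδ hδ' wc hwc ⟨rfl, by omega, by omega⟩
    exact rch_trans (rch_symm step1) (body _ hJ)

/-- **Every vertex is joined to the origin face inside the vertex set.** [folklore] -/
theorem rch_origin {v : HexVertex} (hv : v ∈ (↑(Lam δ wc) : Set HexVertex)) : (v, fj 0 0) ∈ RchRel (↑(Lam δ wc) : Set HexVertex) := by
  rw [← fj_jOf_rOf v] at hv ⊢
  generalize jOf v = j at hv ⊢
  generalize rOf v = r at hv ⊢
  rcases (fj_mem_coe_iff hδ hδ').1 hv with hb | ⟨hwc, hc⟩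
  · by_cases hr : r ≤ 1
    · exact rch_origin_of_le_one hδ hδ' wc hb.1.1.1 hr hv
    · obtain ⟨n, rfl⟩ : ∃ n : ℕ, r = n + 2 := ⟨(r - 2).toNat, by omega⟩
      obtain ⟨j', hj', hR⟩ := exists_rch_row_two hδ hδ' wc n j hb.1
      exact rch_trans hR (rch_origin_of_inStrip_two hδ hδ' wc hj')
  · obtain ⟨rfl, -, -⟩ := hc
    exact rch_origin_of_le_one hδ hδ' wc le_rfl (by norm_num) hv

/-- **The vertex sets are connected.** [folklore] -/
theorem preconnected_Lam : (hexGraph.induce (↑(Lam δ wc) : Set HexVertex)).Preconnected := by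
  intro u v
  obtain ⟨hu, h0, p⟩ := rch_origin hδ hδ' wc u.2
  obtain ⟨hv, h0', q⟩ := rch_origin hδ hδ' wc v.2
  exact p.trans q.symm

/-! ### Connectivity of the complements (simple connectivity) -/


/-- Faces of negative rows are in the complement. [folklore] -/
theorem compl_of_neg {j r : ℤ} (hr : r < 0) : fj j r ∈ (↑(Lam δ wc) : Set HexVertex)ᶜ := by
  rw [fj_mem_compl_iff hδ hδ']
  rintro (hb | ⟨-, hc⟩)
  · have := hb.1.1.1; omega
  · have := hc.1; omega

/-- Faces far to the right are in the complement. [folklore] -/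
theorem compl_of_far_right {j r : ℤ} (hj : 2 * ⌈δ⁻¹⌉ + 2 ≤ j) : fj j r ∈ (↑(Lam δ wc) : Set HexVertex)ᶜ := by
  rw [fj_mem_compl_iff hδ hδ']
  have hc : (δ⁻¹ : ℝ) ≤ ⌈δ⁻¹⌉ := Int.le_ceil _
  have hj' : (2 : ℝ) * ⌈δ⁻¹⌉ + 2 ≤ j := by exact_mod_cast hj
  rintro (hb | ⟨-, hc'⟩)
  · have h0 : (0 : ℝ) ≤ r := by exact_mod_cast hb.1.1.1
    have h1 := hb.1.2
    have hW := W_le_inv hδ r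
    have : reA j r ≤ W δ r := (le_abs_self _).trans h1
    unfold reA at this
    linarith
  · obtain ⟨rfl, -, h2⟩ := hc'
    have hT := (Tc_bounds δ).1
    rw [three_div_four_mul] at hT
    have h2' : (j : ℝ) ≤ 2 * Tc δ + 1 := by exact_mod_cast h2
    have hi : (0:ℝ) < δ⁻¹ := by positivity
    linarith

/-- Faces far to the left (below a given row `r₀`) are in the complement. [folklore] -/
theorem compl_of_far_left {j r r₀ : ℤ} (hr : r ≤ r₀) (hj : j ≤ -(2 * ⌈δ⁻¹⌉ + r₀ + 3)) :
    fj j r ∈ (↑(Lam δ wc) : Set HexVertex)ᶜ := by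
  rw [fj_mem_compl_iff hδ hδ']
  have hc : (δ⁻¹ : ℝ) ≤ ⌈δ⁻¹⌉ := Int.le_ceil _
  have hj' : (j : ℝ) ≤ -(2 * ⌈δ⁻¹⌉ + r₀ + 3) := by exact_mod_cast hj
  have hr' : (r : ℝ) ≤ r₀ := by exact_mod_cast hr
  rintro (hb | ⟨-, hc'⟩)
  · have h1 := hb.1.2
    have hW := W_le_inv hδ r
    have : -W δ r ≤ reA j r := by
      have := neg_abs_le (reA j r)
      linarith
    unfold reA at this
    linarith
  · obtain ⟨rfl, h1, -⟩ := hc'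
    have hX := Xc_pos hδ (δ := δ)
    have h16 : (16 : ℝ) ≤ ⌈δ⁻¹⌉ := (sixteen_le_inv hδ hδ').trans hc
    have h16' : (16 : ℤ) ≤ ⌈δ⁻¹⌉ := by exact_mod_cast h16
    omega

/-- **Dichotomy**: from a complement face of a nonnegative row, the whole half-row to the right
or the whole half-row to the left lies in the complement. [folklore] -/
theorem compl_dichotomy {j r : ℤ} (hr : 0 ≤ r) (h : fj j r ∈ (↑(Lam δ wc) : Set HexVertex)ᶜ) :
    (∀ i, j ≤ i → fj i r ∈ (↑(Lam δ wc) : Set HexVertex)ᶜ) ∨ (∀ i, i ≤ j → fj i r ∈ (↑(Lam δ wc) : Set HexVertex)ᶜ) := by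
  rw [fj_mem_compl_iff hδ hδ'] at h
  by_cases hOK : r ∈ OKRow δ
  · by_cases hS : |reA j r| ≤ W δ r
    · -- a strip face outside the body: bottom rows, right of the junction
      have hIS : (j, r) ∈ Strip δ := ⟨hOK, hS⟩
      have hjX : r ≤ 1 ∧ 2 * Xc δ + 1 < j := by
        by_contra hc
        push Not at hc
        exact h (Or.inl ⟨hIS, hc⟩)
      left
      intro i hi
      rw [fj_mem_compl_iff hδ hδ']
      rintro (hb | ⟨hw, hc⟩)
      · have := hb.2 hjX.1; omega
      · obtain ⟨hr0, hi1, hi2⟩ := hc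
        exact h (Or.inr ⟨hw, hr0, by omega, by omega⟩)
    · rw [not_le] at hS
      rcases le_or_gt 0 (reA j r) with hpos | hneg
      · left
        intro i hi
        have hmono : reA j r ≤ reA i r := by
          unfold reA; have : (j : ℝ) ≤ i := by exact_mod_cast hi
          linarith
        rw [fj_mem_compl_iff hδ hδ']
        rw [abs_of_nonneg hpos] at hS
        rintro (hb | ⟨hw, hc⟩)
        · have := (le_abs_self _).trans hb.1.2
          linarith
        · obtain ⟨rfl, hi1, hi2⟩ := hc
          have hW := Tc_add_two_le_W hδ hδ' (le_refl (0:ℤ)) (by norm_num)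
          have : reA i 0 ≤ Tc δ + 1 := by
            unfold reA; have : (i : ℝ) ≤ 2 * Tc δ + 1 := by exact_mod_cast hi2
            push_cast; linarith
          linarith
      · right
        intro i hi
        have hmono : reA i r ≤ reA j r := by
          unfold reA; have : (i : ℝ) ≤ j := by exact_mod_cast hi
          linarith
        rw [fj_mem_compl_iff hδ hδ']
        rw [abs_of_neg hneg] at hS
        rintro (hb | ⟨hw, hc⟩)
        · have := (neg_abs_le _).trans' (neg_le_neg hb.1.2)
          linarith
        · obtain ⟨rfl, hi1, hi2⟩ := hc
          have hX := Xc_pos hδ (δ := δ)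
          have : (0 : ℝ) ≤ reA i 0 := by
            unfold reA; have : (0 : ℝ) ≤ i := by exact_mod_cast (by omega : (0:ℤ) ≤ i)
            push_cast; linarith
          linarith
  · -- a row above the cap: the whole row is in the complement
    left
    intro i hi
    rw [fj_mem_compl_iff hδ hδ']
    rintro (hb | ⟨hw, hc⟩)
    · exact hOK hb.1.1
    · obtain ⟨rfl, -, -⟩ := hc
      exact hOK (rowOK_of_le_two hδ hδ' le_rfl (by norm_num))

/-- All faces of negative rows: the bottom row `-1` path. [folklore] -/
theorem rch_compl_bottom_row (j : ℤ) : (fj j (-1), fj 0 (-1)) ∈ RchRel (↑(Lam δ wc) : Set HexVertex)ᶜ :=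
  rch_row_of_between (↑(Lam δ wc) : Set HexVertex)ᶜ (-1) j 0 fun i _ _ => compl_of_neg hδ hδ' wc (by norm_num)

/-- From a right-free complement face down to the bottom row. [folklore] -/
theorem rch_compl_of_right {j r : ℤ} (hr : 0 ≤ r) (hR : ∀ i, j ≤ i → fj i r ∈ (↑(Lam δ wc) : Set HexVertex)ᶜ) :
    (fj j r, fj 0 (-1)) ∈ RchRel (↑(Lam δ wc) : Set HexVertex)ᶜ := by
  have h16 : (16 : ℤ) ≤ ⌈δ⁻¹⌉ := by exact_mod_cast (sixteen_le_inv hδ hδ').trans (Int.le_ceil _)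
  set J : ℤ := 2 * (⌈δ⁻¹⌉ + |j| + 2) with hJ
  have hjJ : j ≤ J := by have := le_abs_self j; have := abs_nonneg j; omega
  have hJeven : J % 2 = 0 := by omega
  have hJfar : 2 * ⌈δ⁻¹⌉ + 2 ≤ J := by have := abs_nonneg j; omega
  have step1 : (fj j r, fj J r) ∈ RchRel (↑(Lam δ wc) : Set HexVertex)ᶜ := rch_row (↑(Lam δ wc) : Set HexVertex)ᶜ r j J hjJ fun i hi _ => hR i hi
  obtain ⟨n, hn⟩ : ∃ n : ℕ, (n : ℤ) = r + 1 := ⟨(r + 1).toNat, by omega⟩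
  have step2 : (fj J r, fj J (r - n)) ∈ RchRel (↑(Lam δ wc) : Set HexVertex)ᶜ :=
    rch_col_down (↑(Lam δ wc) : Set HexVertex)ᶜ hJeven r n (hR J hjJ) fun i _ _ =>
      ⟨compl_of_far_right hδ hδ' wc hJfar, compl_of_far_right hδ hδ' wc (by omega)⟩
  rw [hn, show r - (r + 1) = -1 by ring] at step2
  exact rch_trans (rch_trans step1 step2) (rch_compl_bottom_row hδ hδ' wc J)

/-- From a left-free complement face down to the bottom row. [folklore] -/
theorem rch_compl_of_left {j r : ℤ} (hr : 0 ≤ r) (hL : ∀ i, i ≤ j → fj i r ∈ (↑(Lam δ wc) : Set HexVertex)ᶜ) :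
    (fj j r, fj 0 (-1)) ∈ RchRel (↑(Lam δ wc) : Set HexVertex)ᶜ := by
  have h16 : (16 : ℤ) ≤ ⌈δ⁻¹⌉ := by exact_mod_cast (sixteen_le_inv hδ hδ').trans (Int.le_ceil _)
  set J : ℤ := -(2 * (⌈δ⁻¹⌉ + |j| + r + 3)) with hJ
  have hjJ : J ≤ j := by have := neg_abs_le j; have := abs_nonneg j; omega
  have hJeven : J % 2 = 0 := by omega
  have hJfar : J + 1 ≤ -(2 * ⌈δ⁻¹⌉ + r + 3) := by have := abs_nonneg j; omega
  have step1 : (fj j r, fj J r) ∈ RchRel (↑(Lam δ wc) : Set HexVertex)ᶜ := rch_symm (rch_row (↑(Lam δ wc) : Set HexVertex)ᶜ r J j hjJ fun i _ hi => hL i hi)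
  obtain ⟨n, hn⟩ : ∃ n : ℕ, (n : ℤ) = r + 1 := ⟨(r + 1).toNat, by omega⟩
  have step2 : (fj J r, fj J (r - n)) ∈ RchRel (↑(Lam δ wc) : Set HexVertex)ᶜ :=
    rch_col_down (↑(Lam δ wc) : Set HexVertex)ᶜ hJeven r n (hL J hjJ) fun i hi _ =>
      ⟨compl_of_far_left hδ hδ' wc (r₀ := r) (by omega) (by omega),
        compl_of_far_left hδ hδ' wc (r₀ := r) (by omega) hJfar⟩
  rw [hn, show r - (r + 1) = -1 by ring] at step2
  exact rch_trans (rch_trans step1 step2) (rch_compl_bottom_row hδ hδ' wc J)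

/-- From a complement face of a negative row up to the bottom row. [folklore] -/
theorem rch_compl_of_neg {j r : ℤ} (hr : r < 0) : (fj j r, fj 0 (-1)) ∈ RchRel (↑(Lam δ wc) : Set HexVertex)ᶜ := by
  -- first move to an odd face of the same row
  obtain ⟨j₁, hj₁, h₁⟩ : ∃ j₁ : ℤ, j₁ % 2 = 1 ∧ (fj j r, fj j₁ r) ∈ RchRel (↑(Lam δ wc) : Set HexVertex)ᶜ := by
    rcases Int.emod_two_eq_zero_or_one j with hj | hj
    · exact ⟨j + 1, by omega, rch_of_adj (compl_of_neg hδ hδ' wc hr) (compl_of_neg hδ hδ' wc hr)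
        (adj_fj_succ j r)⟩
    · exact ⟨j, hj, rch_rfl (compl_of_neg hδ hδ' wc hr)⟩
  obtain ⟨n, hn⟩ : ∃ n : ℕ, (n : ℤ) = -1 - r := ⟨(-1 - r).toNat, by omega⟩
  have step2 : (fj j₁ r, fj j₁ (r + n)) ∈ RchRel (↑(Lam δ wc) : Set HexVertex)ᶜ :=
    rch_col_up (↑(Lam δ wc) : Set HexVertex)ᶜ hj₁ r n (compl_of_neg hδ hδ' wc hr) fun i _ hi =>
      ⟨compl_of_neg hδ hδ' wc (by omega), compl_of_neg hδ hδ' wc (by omega)⟩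
  rw [hn, show r + (-1 - r) = -1 by ring] at step2
  exact rch_trans (rch_trans h₁ step2) (rch_compl_bottom_row hδ hδ' wc j₁)

/-- **Every complement face is joined to the bottom row inside the complement.** [folklore] -/
theorem rch_compl {v : HexVertex} (hv : v ∈ (↑(Lam δ wc) : Set HexVertex)ᶜ) : (v, fj 0 (-1)) ∈ RchRel (↑(Lam δ wc) : Set HexVertex)ᶜ := by
  rw [← fj_jOf_rOf v] at hv ⊢
  generalize jOf v = j at hv ⊢
  generalize rOf v = r at hv ⊢
  rcases lt_or_ge r 0 with hr | hr
  · exact rch_compl_of_neg hδ hδ' wc hr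
  · rcases compl_dichotomy hδ hδ' wc hr hv with hR | hL
    · exact rch_compl_of_right hδ hδ' wc hr hR
    · exact rch_compl_of_left hδ hδ' wc hr hL

/-- **The vertex sets are simply connected** (connected complement). [folklore] -/
theorem simplyConnected_Lam : hexDomainSimplyConnected (Lam δ wc) := by
  intro u v
  obtain ⟨hu, h0, p⟩ := rch_compl hδ hδ' wc u.2
  obtain ⟨hv, h0', q⟩ := rch_compl hδ hδ' wc v.2
  exact p.trans q.symm

end Connected



end Summit.CriticalPhenomena.SAWScalingLimit.Theorems.BoundaryClosure.Negative
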